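import Literature.Probability.RandomPlanarGeometry.WholePlaneSLEKappaRhoCurve
import Literature.Probability.RandomPlanarGeometry.WholePlaneTipMeasurable
import HarnessLib

/-!
# Whole-plane SLE_κ(ρ) exists given a stationary angle law (`κ ≤ 4`)

Topic `Probability/RandomPlanarGeometry`; theorems only (no definition, no named fact). The
packaging step of Miller–Sheffield (2013), Prop. 2.5 for whole-plane SLE_κ(ρ) in the regime
`0 < κ ≤ 4` (so `κ ≤ 2(ρ + 2)` is the non-hitting regime of `IsStationaryAngleLaw`): **granted a
stationary SLE_κ(ρ) angle law `P₀`**, the product space `Ω = C(ℝ, ℝ) × ℝ` with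
`P = P₀ ⊗ uniformAngleLaw`, the coordinates `X = fst`, `q₀ = snd` and the measurable curve
`wpCurve` (`WholePlaneTipMeasurable`) satisfy `IsWholePlaneSLEKappaRho κ ρ P wpCurve`
(`IsWholePlaneSLEKappaRho.exists_of_isStationaryAngleLaw`): the marginals and independence are
those of a product measure, and almost surely the whole-plane Loewner chain of
`drivingOfAngle q₀ X` is generated by `wpCurve (X, q₀)` (`IsStationaryAngleLaw.ae_isCurve_tip`,
`wpCurve_eq_tip`). What remains for the named fact `IsWholePlaneSLEKappaRho.exists` is the
existence of the stationary angle law (Miller–Sheffield (2013), Prop. 2.1) and the boundary-hitting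
regime `4 < κ ≤ 2(ρ + 2)` of their Prop. 2.5.

## References

* J. Miller, S. Sheffield, *Imaginary geometry IV*, PTRF 169 (2017), arXiv:1302.4738, Prop. 2.5,
  Prop. 2.1. [MillerSheffield2013]
-/

noncomputable section

open MeasureTheory ProbabilityTheory Filter Topology Set
open scoped NNReal Real

namespace Literature.Probability.RandomPlanarGeometry

open scoped PathBorel

variable {κ : ℝ≥0} {ρ : ℝ} {P₀ : Measure C(ℝ, ℝ)}

/-- **Whole-plane SLE_κ(ρ) on the product space, given a stationary angle law (`κ ≤ 4`).**
[cite: MillerSheffield2013, Prop. 2.5] -/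
theorem isWholePlaneSLEKappaRho_prod_of_isStationaryAngleLaw (hP₀ : IsStationaryAngleLaw κ ρ P₀)
    (hκ : 0 < κ) (hκ4 : κ ≤ 4) :
    IsWholePlaneSLEKappaRho κ ρ (P₀.prod uniformAngleLaw) wpCurve := by
  haveI := hP₀.isProbabilityMeasure
  refine ⟨measurable_wpCurve, Prod.fst, Prod.snd, measurable_fst, measurable_snd, ?_, ?_, ?_, ?_⟩
  · rw [Measure.map_fst_prod, measure_univ, one_smul]; exact hP₀
  · rw [Measure.map_snd_prod, measure_univ, one_smul]
  · exact indepFun_prod measurable_id measurable_id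
  · -- the good set of angle paths
    set Good : Set C(ℝ, ℝ) := {x | (∀ t, x t ∈ Ioo 0 (2 * π)) ∧ ∀ q₀ : ℝ,
      Continuous (drivingOfAngle q₀ x) ∧
      (∀ C : WholePlaneLoewnerChain (drivingOfAngle q₀ x), C.IsCurve (WholePlaneLoewner.tip (drivingOfAngle q₀ x))) ∧
      ∀ s : ℝ, Tendsto (fun R : ℝ ↦ WholePlaneLoewner.BackwardFlow.invMap (drivingOfAngle q₀ x) s
          ((R : ℂ) * Complex.exp ((drivingOfAngle q₀ x s : ℝ) * Complex.I)))
        (𝓝[>] 1) (𝓝 (WholePlaneLoewner.tip (drivingOfAngle q₀ x) s))} with hGood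
    have hGoodae : ∀ᵐ x ∂P₀, x ∈ Good := by
      filter_upwards [hP₀.2.1, hP₀.ae_isCurve_tip hκ hκ4] with x h1 h2
      exact ⟨h1, h2⟩
    have hnull : (P₀.prod uniformAngleLaw) {ω | ω.1 ∉ Good} = 0 := by
      have h1 : {ω : C(ℝ, ℝ) × ℝ | ω.1 ∉ Good} = Goodᶜ ×ˢ (univ : Set ℝ) := by
        ext ω; simp
      rw [h1, Measure.prod_prod]
      have h2 : P₀ Goodᶜ = 0 := by
        have := ae_iff.1 hGoodae
        rwa [show {a | a ∉ Good} = Goodᶜ from rfl] at this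
      rw [h2, zero_mul]
    have hae : ∀ᵐ ω ∂P₀.prod uniformAngleLaw, ω.1 ∈ Good := by
      rw [ae_iff]; simpa using hnull
    filter_upwards [hae] with ω hω
    obtain ⟨hI, hq⟩ := hω
    obtain ⟨hcont, hcurve, htend⟩ := hq ω.2
    obtain ⟨⟨C⟩, -⟩ := WholePlaneLoewnerChain.exists_unique_holds _ hcont
    refine ⟨C, ?_⟩
    have hgood : ω.1 ∈ goodAnglePaths := mem_goodAnglePaths_iff.2 hI
    have heq : wpCurve ω = WholePlaneLoewner.tip (drivingOfAngle ω.2 ω.1) := by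
      funext t
      exact wpCurve_eq_tip hgood (htend t)
    rw [heq]
    exact hcurve C

/-- **`IsWholePlaneSLEKappaRho.exists` for `0 < κ ≤ 4`, given a stationary SLE_κ(ρ) angle law.**
[cite: MillerSheffield2013, Prop. 2.5] -/
theorem IsWholePlaneSLEKappaRho.exists_of_isStationaryAngleLaw (hP₀ : IsStationaryAngleLaw κ ρ P₀)
    (hκ : 0 < κ) (hκ4 : κ ≤ 4) :
    ∃ (Ω : Type) (_ : MeasurableSpace Ω) (P : Measure Ω) (γ : Ω → ℝ → ℂ),
      IsProbabilityMeasure P ∧ IsWholePlaneSLEKappaRho κ ρ P γ := by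
  haveI := hP₀.isProbabilityMeasure
  exact ⟨C(ℝ, ℝ) × ℝ, inferInstance, P₀.prod uniformAngleLaw, wpCurve, inferInstance,
    isWholePlaneSLEKappaRho_prod_of_isStationaryAngleLaw hP₀ hκ hκ4⟩

/-- **Whole-plane SLE_κ(ρ) exists for `0 < κ ≤ 4`, `κ ≤ 2(ρ + 2)`, granted the stationary angle
law** — the part of the named fact `IsWholePlaneSLEKappaRho.exists` that the printed proof of
Miller–Sheffield (2013), Prop. 2.5 establishes in the non-hitting regime `ρ ≥ κ/2 - 2`, with its
remaining input, the existence of the stationary SLE_κ(ρ) angle law (op. cit., Prop. 2.1, the named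
fact `IsStationaryAngleLaw.exists_unique`), taken as a hypothesis. Scope note (why `κ ≤ 4` and not
the whole range `κ ≤ 2(ρ + 2)` of `IsWholePlaneSLEKappaRho.exists`): for `ρ ≥ κ/2 - 2` the printed
proof of Prop. 2.5 rests on Lemma 2.4 ("`η` almost surely does not intersect `∂𝐃` and is a simple
path"), which is deduced there only from the fact that `θ = arg W - arg O` does not hit `{0, 2π}`.
That controls the force point alone: seen from the driving point, the angle of any other boundary
point is, near a collision and while `θ` stays inside `(0, 2π)`, absolutely continuous with respect
to `√κ` times a Bessel process of dimension `1 + 4/κ`, which is `< 2` for `κ > 4`; so for `κ > 4`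
radial SLE_κ(ρ) does meet the boundary — as op. cit., Prop. 4.9 itself records (the maximal number
of boundary intersections of radial SLE_κ'(ρ), `ρ ≥ κ'/2 - 2`, is
`max(⌈(κ' - 4)/(2(2 + ρ))⌉, I(κ') - 1) ≥ 1`) — while the second mechanism of that proof (Lemma 2.6:
the whole boundary is eventually cut off from the target) is unavailable, the force point being
never cut off. Hence the source's argument covers exactly `κ ≤ 4`, formalised in
`IsWholePlaneSLEKappaRho.exists_of_isStationaryAngleLaw`; the regime `4 < κ ≤ 2(ρ + 2)` of the
named fact has no proof in the source. [cite: MillerSheffield2013, Prop. 2.5 and Prop. 2.1] -/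
theorem IsWholePlaneSLEKappaRho.exists_of_le_four (hlaw : IsStationaryAngleLaw.exists_unique)
    (κ : ℝ≥0) (ρ : ℝ) (hκ : 0 < κ) (hκ4 : κ ≤ 4) (hκρ : (κ : ℝ) ≤ 2 * (ρ + 2)) :
    ∃ (Ω : Type) (_ : MeasurableSpace Ω) (P : Measure Ω) (γ : Ω → ℝ → ℂ),
      IsProbabilityMeasure P ∧ IsWholePlaneSLEKappaRho κ ρ P γ := by
  obtain ⟨P₀, hP₀, -⟩ := hlaw κ ρ hκ hκρ
  exact IsWholePlaneSLEKappaRho.exists_of_isStationaryAngleLaw hP₀ hκ hκ4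

end Literature.Probability.RandomPlanarGeometry
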